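import Mathlib
import Literature.NumberTheory.Sieve.LinearPairDivisorShortSums
import Literature.NumberTheory.Sieve.LinearPairDivisorShells
import Summits.Parity.BatemanHorn.Theorems.PolynomialMobiusPolyMobiusTailStubPairMiddleShellCards
import Summits.Parity.BatemanHorn.Theorems.PolynomialMobiusPolyMobiusTailStubPairMiddlePerBox
import Summits.Parity.BatemanHorn.Theorems.PolynomialMobiusPolyMobiusTailStubPairMiddleArith
import Summits.Parity.BatemanHorn.Theorems.PolynomialMobiusPolyMobiusTailStubPairMiddleSmallPart
import Summits.Parity.BatemanHorn.Theorems.PolynomialMobiusPolyMobiusTailStubPairMiddleBoxDisp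

/-!
# Crux `PolyMobiusTail` (stmt-Parity-0870), line `eta-free-multilinear-window`, stub `stub_pair_middle` — helper 5:
# the boxes part of the one-sided middle triple sum (shells + dispersion over the fine `(d₀, m)`-grid;
# head = registered auxiliary stub `stub_pair_middle_boxes_part`)
-/

open scoped BigOperators
open Finset Real Filter Polynomial Asymptotics

namespace Summit.Parity.BatemanHorn.Theorems.PolyMobiusTail.EtaFreeWindow

namespace MiddleAssembly

open Literature.NumberTheory.Sieve Literature.NumberTheory.Sieve.GeometricGrid Literature.NumberTheory.Sieve.LinearPairConfig

set_option maxHeartbeats 800000 in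
/-- **The boxes part of the one-sided middle triple sum** (`m > M₀ = ⌊x^{σ₁/2}⌋₊`): shells + dispersion
over the fine `(d₀, m)`-grid. -/
theorem boxes_part_le {q₀ a₀ q₁ a₁ : ℤ} (hq₀ : 0 < q₀) (hq₁ : 0 < q₁) (hc₀ : IsCoprime q₀ a₀)
    (hc₁ : IsCoprime q₁ a₁) (hΔ : q₁ * a₀ - q₀ * a₁ ≠ 0) {σ₁ σ₂ : ℝ} (hσ₁ : 0 < σ₁) (h12 : σ₁ < σ₂)
    (hσ₂ : σ₂ < 1 / 2) :
    ∃ C : ℝ, 0 < C ∧ ∃ e : ℕ, ∃ ν : ℝ, 0 < ν ∧ ∃ X₀ : ℕ, ∀ (x : ℕ) (θ η : ℝ), X₀ ≤ x →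
      0 < θ → θ ≤ min (σ₁ / 4) (min ((1 / 2 - σ₂) / 4) (1 / 16)) →
      0 < η → η ≤ min (σ₁ / 4) (min ((1 / 2 - σ₂) / 4) (1 / 16)) →
      |∑ d₀ ∈ Icc 1 ((q₀.toNat + q₁.toNat) * x + a₀.natAbs + a₁.natAbs),
        ∑ d₁ ∈ Icc 1 ((q₀.toNat + q₁.toNat) * x + a₀.natAbs + a₁.natAbs),
          ∑ m ∈ Ioc ⌊(x : ℝ) ^ (σ₁ / 2)⌋₊ ((q₀.toNat + q₁.toNat) * x + a₀.natAbs + a₁.natAbs),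
          (if ((d₁ : ℤ) * m - a₁) % q₁ = 0 ∧
              (1 ≤ ((d₁ : ℤ) * m - a₁) / q₁ ∧ ((d₁ : ℤ) * m - a₁) / q₁ ≤ x) ∧
              (1 ≤ q₀ * (((d₁ : ℤ) * m - a₁) / q₁) + a₀ ∧ (d₀ : ℤ) ∣ q₀ * (((d₁ : ℤ) * m - a₁) / q₁) + a₀) ∧
              ((x : ℝ) ^ (1 - η) < (d₀ : ℝ) * d₁ ∧ (d₀ : ℝ) * d₁ ≤ (x : ℝ) ^ (1 + θ) ∧
                ((x : ℝ) ^ σ₁ < (d₀ : ℝ) ∧ (d₀ : ℝ) ≤ (x : ℝ) ^ σ₂)) then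
            ((ArithmeticFunction.moebius d₀ : ℝ) * Real.log d₀) *
              ((ArithmeticFunction.moebius d₁ : ℝ) * Real.log d₁) else 0)| ≤
      C * ((x : ℝ) / (1 + Real.log x) + (1 + Real.log x) ^ e * (x : ℝ) ^ (1 - ν)) := by
  classical
  obtain ⟨Csh, hCsh, hsh⟩ := LinearPairShells.card_shell_le hc₀ hc₁ hq₀ hq₁ hΔ 3
  obtain ⟨Cτ, hCτ, c, hτ⟩ := LinearPairShells.sum_Ioc_card_divisors_mul_le hq₀ hq₁ a₀ a₁
  set kκ : ℕ := c + 9 with hkκ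
  set c₄ : ℝ := (1 / 2 - σ₂) / 4 with hc₄
  have hc₄0 : 0 < c₄ := by rw [hc₄]; linarith
  set δ : ℝ := min c₄ (1 / 16) with hδ
  have hδ0 : 0 < δ := lt_min hc₄0 (by norm_num)
  obtain ⟨hδc₄, hδ16⟩ : δ ≤ c₄ ∧ δ ≤ 1 / 16 := ⟨min_le_left _ _, min_le_right _ _⟩
  set Ad : ℝ := ((2 * kκ + 4 : ℕ) : ℝ) with hAd
  obtain ⟨K, hK, x₀, hdisp⟩ := stub_pair_middle_boxdisp q₀ a₀ q₁ a₁ σ₁ σ₂ δ Ad hq₀ hq₁ hΔ hσ₁ h12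
    (by linarith) hδ0
  set ν : ℝ := min (σ₁ / 4) δ with hν
  have hν0 : 0 < ν := lt_min (by linarith) hδ0
  obtain ⟨hνσ, hνδ⟩ : ν ≤ σ₁ / 4 ∧ ν ≤ δ := ⟨min_le_left _ _, min_le_right _ _⟩
  have hq₁R : (1 : ℝ) ≤ q₁ := by exact_mod_cast hq₁
  set L₀ : ℕ := q₁.toNat + a₁.natAbs + q₁.toNat * (a₀.natAbs + 1) + 2 with hL₀
  set Bq : ℕ := q₀.toNat + q₁.toNat + a₀.natAbs + a₁.natAbs + 2 with hBq
  have e1 := eventually_ge_atTop x₀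
  have e2 := eventually_ge_atTop 3
  have e3 : ∀ᶠ x : ℕ in atTop, (Bq : ℝ) ≤ (x : ℝ) := tendsto_natCast_atTop_atTop.eventually_ge_atTop _
  have e4 : ∀ᶠ x : ℕ in atTop, (4 : ℝ) ≤ 1 + Real.log x := by
    have := (Real.tendsto_log_atTop.comp tendsto_natCast_atTop_atTop).eventually_ge_atTop (3 : ℝ)
    filter_upwards [this] with x hx
    simp only [Function.comp] at hx
    linarith
  have e5 := GeometricGrid.eventually_mul_log_pow_le_rpow 6 kκ (s := σ₁ / 2) (by linarith)
  have e6 : ∀ᶠ x : ℕ in atTop, (32 : ℝ) ≤ (x : ℝ) ^ (σ₁ / 2) :=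
    ((tendsto_rpow_atTop (by linarith)).comp tendsto_natCast_atTop_atTop).eventually_ge_atTop _
  have e7 : ∀ᶠ x : ℕ in atTop, (L₀ : ℝ) ≤ (x : ℝ) ^ (1 / 4 : ℝ) :=
    ((tendsto_rpow_atTop (by norm_num)).comp tendsto_natCast_atTop_atTop).eventually_ge_atTop _
  obtain ⟨X₀, hX₀⟩ := Filter.eventually_atTop.mp (e1.and (e2.and (e3.and (e4.and (e5.and (e6.and e7))))))
  refine ⟨180 * Csh + 36 * Cτ + 100 * K + 18 * Cτ + 25 * K * (4 + 4 * Real.sqrt (2 * q₁)), by positivity,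
    2 * kκ + 6, ν, hν0, X₀, ?_⟩
  intro x θ η hxX hθ0 hθ hη0 hη
  obtain ⟨hxx₀, hx3, hxB, hL4, hxM6, hx32, hxL₀⟩ := hX₀ x hxX
  have hθc₄ : θ ≤ c₄ := hθ.trans ((min_le_right _ _).trans (min_le_left _ _))
  have hθ16 : θ ≤ 1 / 16 := hθ.trans ((min_le_right _ _).trans (min_le_right _ _))
  have hη16 : η ≤ 1 / 16 := hη.trans ((min_le_right _ _).trans (min_le_right _ _))
  have hx1 : 1 ≤ x := le_trans (by norm_num) hx3
  have hx1R : (1 : ℝ) ≤ x := by exact_mod_cast hx1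
  have hx0R : (0 : ℝ) < x := by linarith
  have hx3R : (3 : ℝ) ≤ x := by exact_mod_cast hx3
  set L : ℝ := 1 + Real.log x with hL
  have hlog1 : 1 ≤ Real.log x := by
    rw [Real.le_log_iff_exp_le hx0R]
    exact (Real.exp_one_lt_d9.le.trans (by norm_num)).trans hx3R
  have hlogL : Real.log x ≤ L := by rw [hL]; linarith only
  have hL1 : 1 ≤ L := by rw [hL]; linarith only [hlog1]
  obtain ⟨hL0, hLlog⟩ : 0 < L ∧ L ≤ 2 * Real.log x := ⟨by linarith only [hL1], by rw [hL]; linarith only [hlog1]⟩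
  set κ : ℝ := (L ^ kκ)⁻¹ with hκdef
  have hLk1 : 1 ≤ L ^ kκ := one_le_pow₀ hL1
  have hκ0 : 0 < κ := by positivity
  obtain ⟨hκ1, hκL⟩ : κ ≤ 1 ∧ κ * L ^ kκ = 1 := ⟨inv_le_one_of_one_le₀ hLk1, inv_mul_cancel₀ (by positivity)⟩
  have hLk8 : (8 : ℝ) ≤ L ^ kκ := by
    calc (8 : ℝ) ≤ 4 ^ 2 := by norm_num
      _ ≤ L ^ 2 := pow_le_pow_left₀ (by norm_num) hL4 2
      _ ≤ L ^ kκ := pow_le_pow_right₀ hL1 (by omega)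
  have hκ8 : κ ≤ 1 / 8 := by rw [hκdef]; exact (inv_anti₀ (by norm_num) hLk8).trans (by norm_num)
  have hκ4 : κ ≤ 1 / 4 := hκ8.trans (by norm_num)
  set Xb : ℕ := (q₀.toNat + q₁.toNat) * x + a₀.natAbs + a₁.natAbs with hXb
  have hXb1 : 1 ≤ Xb := by
    have : 1 ≤ (q₀.toNat + q₁.toNat) * x := Nat.one_le_iff_ne_zero.mpr (Nat.mul_ne_zero (by omega) (by omega))
    omega
  have hxXb : x ≤ Xb := by
    have : x ≤ (q₀.toNat + q₁.toNat) * x := Nat.le_mul_of_pos_left x (by omega)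
    omega
  have hBqR : (Bq : ℝ) = (q₀.toNat : ℝ) + q₁.toNat + a₀.natAbs + a₁.natAbs + 2 := by rw [hBq]; push_cast; ring
  have hXbR : (Xb : ℝ) = ((q₀.toNat : ℝ) + q₁.toNat) * x + a₀.natAbs + a₁.natAbs := by rw [hXb]; push_cast; ring
  have hXbx2 : (Xb : ℝ) ≤ (x : ℝ) ^ (2 : ℝ) := by
    rw [Real.rpow_two, hXbR]
    have hB : (Bq : ℝ) ≤ x := hxB
    rw [hBqR] at hB
    have ha : (0 : ℝ) ≤ a₀.natAbs := Nat.cast_nonneg _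
    have hb : (0 : ℝ) ≤ a₁.natAbs := Nat.cast_nonneg _
    have h1 : ((q₀.toNat : ℝ) + q₁.toNat) * x ≤ ((x : ℝ) - a₀.natAbs - a₁.natAbs - 2) * x :=
      mul_le_mul_of_nonneg_right (by linarith only [hB]) hx0R.le
    nlinarith only [h1, ha, hb, hx1R]
  have haxR : (a₁.natAbs : ℝ) ≤ x := by
    have := hxB; rw [hBqR] at this
    have ha : (0 : ℝ) ≤ a₀.natAbs := Nat.cast_nonneg _
    have hq : (0 : ℝ) ≤ (q₀.toNat : ℝ) + q₁.toNat := by positivity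
    linarith only [this, ha, hq]
  have hax : a₁.natAbs ≤ x := by exact_mod_cast haxR
  have hLXb : 1 + Real.log Xb ≤ 3 * L := by
    have h1 : Real.log Xb ≤ Real.log ((x : ℝ) ^ (2 : ℝ)) := Real.log_le_log (by exact_mod_cast hXb1) hXbx2
    rw [Real.log_rpow hx0R] at h1
    rw [hL]; linarith only [h1, hlog1]
  have hLXb0 : 0 ≤ 1 + Real.log Xb := by
    have : 0 ≤ Real.log Xb := Real.log_nonneg (by exact_mod_cast hXb1); linarith only [this]
  set BP : ℕ := ⌊(x : ℝ) ^ σ₁⌋₊ with hBP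
  set TP : ℕ := ⌊(x : ℝ) ^ σ₂⌋₊ with hTP
  have hxσ₁ : (x : ℝ) ^ (σ₁ / 2) ≤ (x : ℝ) ^ σ₁ := Real.rpow_le_rpow_of_exponent_le hx1R (by linarith)
  have hxσ₁σ₂ : (x : ℝ) ^ σ₁ ≤ (x : ℝ) ^ σ₂ := Real.rpow_le_rpow_of_exponent_le hx1R h12.le
  have hxσ₂x : (x : ℝ) ^ σ₂ ≤ x := by
    calc (x : ℝ) ^ σ₂ ≤ (x : ℝ) ^ (1 : ℝ) := Real.rpow_le_rpow_of_exponent_le hx1R (by linarith)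
      _ = x := Real.rpow_one _
  have hBPTP : BP ≤ TP := Nat.floor_le_floor hxσ₁σ₂
  have hBPge : (x : ℝ) ^ σ₁ - 1 ≤ BP := by
    have := Nat.lt_floor_add_one ((x : ℝ) ^ σ₁); rw [← hBP] at this; linarith only [this]
  have hBP16 : (16 : ℝ) ≤ BP := by linarith only [hBPge, hx32, hxσ₁]
  have hBP1 : 1 ≤ BP := by exact_mod_cast (show (1 : ℝ) ≤ BP by linarith only [hBP16])
  have hTPle : (TP : ℝ) ≤ (x : ℝ) ^ σ₂ := Nat.floor_le (by positivity)
  have hTPx : TP ≤ x := by exact_mod_cast hTPle.trans hxσ₂x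
  have hTPXb : TP ≤ Xb := hTPx.trans hxXb
  set M₀ : ℕ := ⌊(x : ℝ) ^ (σ₁ / 2)⌋₊ with hM₀
  have hM₀ge : (x : ℝ) ^ (σ₁ / 2) - 1 ≤ M₀ := by
    have := Nat.lt_floor_add_one ((x : ℝ) ^ (σ₁ / 2)); rw [← hM₀] at this; linarith only [this]
  have hM₀le : (M₀ : ℝ) ≤ (x : ℝ) ^ (σ₁ / 2) := Nat.floor_le (by positivity)
  have hM₀κ : 3 * L ^ kκ + 15 ≤ (M₀ : ℝ) := by linarith only [hxM6, hx32, hM₀ge]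
  have hM₀1 : 1 ≤ M₀ := by
    have h0 : (0 : ℝ) ≤ 3 * L ^ kκ := by positivity
    exact_mod_cast (show (1 : ℝ) ≤ M₀ by linarith only [hM₀κ, h0])
  set TMr : ℝ := 2 * q₁ * (x : ℝ) ^ (σ₂ + η) with hTMr
  set TM : ℕ := min Xb ⌊TMr⌋₊ with hTM
  have hTMXb : TM ≤ Xb := min_le_left _ _
  have hM₀TM : M₀ ≤ TM := by
    refine le_min ?_ (Nat.floor_le_floor ?_)
    · have : (M₀ : ℝ) ≤ x := hM₀le.trans (hxσ₁.trans (hxσ₁σ₂.trans hxσ₂x))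
      exact le_trans (by exact_mod_cast this) hxXb
    · have hle : σ₁ / 2 ≤ σ₂ + η := by linarith only [h12, hη0, hσ₁]
      have h1 : (x : ℝ) ^ (σ₁ / 2) ≤ (x : ℝ) ^ (σ₂ + η) := Real.rpow_le_rpow_of_exponent_le hx1R hle
      have h0 : 0 ≤ (x : ℝ) ^ (σ₂ + η) := by positivity
      have h2 : (x : ℝ) ^ (σ₂ + η) ≤ (2 * q₁) * (x : ℝ) ^ (σ₂ + η) :=
        le_mul_of_one_le_left h0 (by linarith only [hq₁R])
      exact h1.trans (by linarith only [h2])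
  have hTM1 : 1 ≤ TM := hM₀1.trans hM₀TM
  have hlogTP : Real.log TP ≤ L := by
    have hTP1 : (1 : ℝ) ≤ TP := by exact_mod_cast hBP1.trans hBPTP
    have : Real.log TP ≤ Real.log x := Real.log_le_log (by linarith only [hTP1]) (by exact_mod_cast hTPx)
    linarith only [this, hlogL]
  have hlogTM : Real.log TM ≤ 2 * L := by
    have hTM1R : (1 : ℝ) ≤ TM := by exact_mod_cast hTM1
    have h4 : Real.log TM ≤ Real.log Xb := Real.log_le_log (by linarith only [hTM1R]) (by exact_mod_cast hTMXb)
    have h3 : Real.log Xb ≤ 2 * Real.log x := by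
      have := Real.log_le_log (by exact_mod_cast hXb1) hXbx2
      rwa [Real.log_rpow hx0R] at this
    linarith only [h4, h3, hlogL]
  have hBPlow : 6 * L ^ kκ - 1 ≤ (BP : ℝ) := by linarith only [hxM6, hxσ₁, hBPge]
  obtain ⟨SP, SM, bP, bM, hbPmono, hbMmono, hbP0, hbPS, hbM0, hbMS, hSPle, hSMle, hbPge, hbMge, hsuccP, hsuccM,
    hratP, hratM, hκBP, hκM₀⟩ := grid_facts hL1 hκ0 hκ1 hκL hLk1 hBP1 hBPTP hM₀1 hM₀TM hlogTP hlogTM hBPlow hM₀κ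
  set g : ℕ → ℕ → ℕ → ℝ := fun d₀ d₁ m =>
    (if ((d₁ : ℤ) * m - a₁) % q₁ = 0 ∧
        (1 ≤ ((d₁ : ℤ) * m - a₁) / q₁ ∧ ((d₁ : ℤ) * m - a₁) / q₁ ≤ x) ∧
        (1 ≤ q₀ * (((d₁ : ℤ) * m - a₁) / q₁) + a₀ ∧ (d₀ : ℤ) ∣ q₀ * (((d₁ : ℤ) * m - a₁) / q₁) + a₀) ∧
        ((x : ℝ) ^ (1 - η) < (d₀ : ℝ) * d₁ ∧ (d₀ : ℝ) * d₁ ≤ (x : ℝ) ^ (1 + θ) ∧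
          ((x : ℝ) ^ σ₁ < (d₀ : ℝ) ∧ (d₀ : ℝ) ≤ (x : ℝ) ^ σ₂)) then
      ((ArithmeticFunction.moebius d₀ : ℝ) * Real.log d₀) *
        ((ArithmeticFunction.moebius d₁ : ℝ) * Real.log d₁) else 0) with hg
  have hsupp : ∀ d₀ d₁ m, g d₀ d₁ m ≠ 0 → (BP < d₀ ∧ d₀ ≤ TP) ∧ m ≤ TM := by
    intro d₀ d₁ m h
    have hc : ((d₁ : ℤ) * m - a₁) % q₁ = 0 ∧
        (1 ≤ ((d₁ : ℤ) * m - a₁) / q₁ ∧ ((d₁ : ℤ) * m - a₁) / q₁ ≤ x) ∧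
        (1 ≤ q₀ * (((d₁ : ℤ) * m - a₁) / q₁) + a₀ ∧ (d₀ : ℤ) ∣ q₀ * (((d₁ : ℤ) * m - a₁) / q₁) + a₀) ∧
        ((x : ℝ) ^ (1 - η) < (d₀ : ℝ) * d₁ ∧ (d₀ : ℝ) * d₁ ≤ (x : ℝ) ^ (1 + θ) ∧
          ((x : ℝ) ^ σ₁ < (d₀ : ℝ) ∧ (d₀ : ℝ) ≤ (x : ℝ) ^ σ₂)) := by
      by_contra hc; exact h (if_neg hc)
    obtain ⟨h1, h2, h3, h4⟩ := true_summand_support (σ₁ := σ₁) (σ₂ := σ₂) (θ := θ) (η := η) hq₀ hq₁ hx1 haxR hc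
    exact ⟨⟨h1, h2⟩, le_min h3 (Nat.le_floor h4)⟩
  have hM₀Xb : M₀ ≤ Xb := hM₀TM.trans hTMXb
  have hdec := GeometricGrid.tripleSum_decomp g bP bM hbPmono hbMmono hbP0 hbPS hbM0 hbMS hTPXb hM₀TM hTMXb
    (fun d₀ d₁ m h => (hsupp d₀ d₁ m h).1) (fun d₀ d₁ m h => (hsupp d₀ d₁ m h).2)
  have hboxes : ∑ d₀ ∈ Icc 1 Xb, ∑ d₁ ∈ Icc 1 Xb, ∑ m ∈ Ioc M₀ Xb, g d₀ d₁ m =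
      ∑ s ∈ range SP, ∑ j ∈ range SM,
        ∑ d₀ ∈ Ioc (bP s) (bP (s + 1)), ∑ d₁ ∈ Icc 1 Xb, ∑ m ∈ Ioc (bM j) (bM (j + 1)), g d₀ d₁ m := by
    have hsplit : ∑ d₀ ∈ Icc 1 Xb, ∑ d₁ ∈ Icc 1 Xb, ∑ m ∈ Icc 1 Xb, g d₀ d₁ m =
        (∑ d₀ ∈ Icc 1 Xb, ∑ d₁ ∈ Icc 1 Xb, ∑ m ∈ Icc 1 M₀, g d₀ d₁ m) +
        ∑ d₀ ∈ Icc 1 Xb, ∑ d₁ ∈ Icc 1 Xb, ∑ m ∈ Ioc M₀ Xb, g d₀ d₁ m := by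
      rw [← Finset.sum_add_distrib]
      refine Finset.sum_congr rfl fun d₀ _ => ?_
      rw [← Finset.sum_add_distrib]
      refine Finset.sum_congr rfl fun d₁ _ => ?_
      exact GeometricGrid.sum_Icc_one_eq_add hM₀Xb _
    linarith only [hsplit, hdec]
  show |∑ d₀ ∈ Icc 1 Xb, ∑ d₁ ∈ Icc 1 Xb, ∑ m ∈ Ioc M₀ Xb, g d₀ d₁ m| ≤ _
  rw [hboxes]
  set Dunif : ℝ := 3 * L ^ 4 * (x : ℝ) ^ (1 - ν) + 4 * κ * x / L ^ Ad +
    (4 * Real.sqrt (2 * q₁) + 1) * (x : ℝ) ^ (1 - ν) with hDunif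
  have hLAd : L ^ Ad = L ^ (2 * kκ + 4) := by rw [hAd, Real.rpow_natCast]
  have hDunif0 : 0 ≤ Dunif := by
    have : 0 < L ^ Ad := by rw [hLAd]; positivity
    rw [hDunif]; positivity
  have hperbox : ∀ s ∈ range SP, ∀ j ∈ range SM,
      |∑ d₀ ∈ Ioc (bP s) (bP (s + 1)), ∑ d₁ ∈ Icc 1 Xb, ∑ m ∈ Ioc (bM j) (bM (j + 1)), g d₀ d₁ m| ≤
      (1 + Real.log Xb) ^ 2 *
        ((((Finset.Ioc (bP s) (bP (s + 1)) ×ˢ Finset.Icc 1 Xb) ×ˢ Finset.Ioc (bM j) (bM (j + 1))).filter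
          (fun c : (ℕ × ℕ) × ℕ =>
            (((c.1.2 : ℤ) * c.2 - a₁) % q₁ = 0 ∧
              (1 ≤ ((c.1.2 : ℤ) * c.2 - a₁) / q₁ ∧ ((c.1.2 : ℤ) * c.2 - a₁) / q₁ ≤ x) ∧
              (1 ≤ q₀ * (((c.1.2 : ℤ) * c.2 - a₁) / q₁) + a₀ ∧
                (c.1.1 : ℤ) ∣ q₀ * (((c.1.2 : ℤ) * c.2 - a₁) / q₁) + a₀)) ∧
            (((x : ℝ) ^ (1 - η) < (c.1.1 : ℝ) * c.1.2 ∧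
                (c.1.1 : ℝ) * c.1.2 ≤ (x : ℝ) ^ (1 - η) * (bP (s + 1) : ℕ) / (bP s : ℕ)) ∨
             ((x : ℝ) ^ (1 + θ) * (bP s : ℕ) / (bP (s + 1) : ℕ) < (c.1.1 : ℝ) * c.1.2 ∧
                (c.1.1 : ℝ) * c.1.2 ≤ (x : ℝ) ^ (1 + θ)) ∨
             (((q₁ : ℝ) * x + a₁) * ((bM j : ℕ) + 1) / (bM (j + 1) : ℕ) < (c.1.2 : ℝ) * c.2)))).card : ℝ) +
      K * Dunif := by
    intro s hs j hj
    rw [Finset.mem_range] at hs hj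
    by_cases hP : bP s < bP (s + 1)
    swap
    · have h0 : ∑ d₀ ∈ Ioc (bP s) (bP (s + 1)), ∑ d₁ ∈ Icc 1 Xb, ∑ m ∈ Ioc (bM j) (bM (j + 1)), g d₀ d₁ m = 0 := by
        rw [Finset.Ioc_eq_empty hP, Finset.sum_empty]
      rw [h0, abs_zero]
      exact add_nonneg (mul_nonneg (pow_nonneg hLXb0 2) (Nat.cast_nonneg _)) (mul_nonneg hK.le hDunif0)
    by_cases hMj : bM j < bM (j + 1)
    swap
    · have h0 : ∑ d₀ ∈ Ioc (bP s) (bP (s + 1)), ∑ d₁ ∈ Icc 1 Xb, ∑ m ∈ Ioc (bM j) (bM (j + 1)), g d₀ d₁ m = 0 := by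
        refine Finset.sum_eq_zero fun _ _ => Finset.sum_eq_zero fun _ _ => ?_
        rw [Finset.Ioc_eq_empty hMj, Finset.sum_empty]
      rw [h0, abs_zero]
      exact add_nonneg (mul_nonneg (pow_nonneg hLXb0 2) (Nat.cast_nonneg _)) (mul_nonneg hK.le hDunif0)
    have hPR : (BP : ℝ) ≤ bP s := hbPge s
    have hPpos : 0 < bP s := by exact_mod_cast (show (0 : ℝ) < bP s by linarith only [hPR, hBP16])
    have hP'TP : bP (s + 1) ≤ TP := by rw [← hbPS]; exact hbPmono (Nat.succ_le_of_lt hs)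
    have hP'Xb : bP (s + 1) ≤ Xb := hP'TP.trans hTPXb
    have hMb'TM : bM (j + 1) ≤ TM := by rw [← hbMS]; exact hbMmono (Nat.succ_le_of_lt hj)
    have hMb'Xb : bM (j + 1) ≤ Xb := hMb'TM.trans hTMXb
    have hP'R : ((bP (s + 1) : ℕ) : ℝ) ≤ (x : ℝ) ^ σ₂ := le_trans (by exact_mod_cast hP'TP) hTPle
    have hL₀P : (L₀ : ℝ) ≤ (x : ℝ) ^ (1 - η) / (bP s : ℕ) := by
      have hPσ : ((bP s : ℕ) : ℝ) ≤ (x : ℝ) ^ σ₂ :=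
        le_trans (by exact_mod_cast (hbPmono (Nat.le_succ s)).trans hP'TP) hTPle
      have hP0 : (0 : ℝ) < (bP s : ℕ) := by exact_mod_cast hPpos
      rw [le_div_iff₀ hP0]
      have h1 : (L₀ : ℝ) * (bP s : ℕ) ≤ (x : ℝ) ^ (1 / 4 : ℝ) * (x : ℝ) ^ σ₂ :=
        mul_le_mul hxL₀ hPσ hP0.le (by positivity)
      have h2 : (x : ℝ) ^ (1 / 4 : ℝ) * (x : ℝ) ^ σ₂ ≤ (x : ℝ) ^ (1 - η) := by
        rw [← Real.rpow_add hx0R]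
        exact Real.rpow_le_rpow_of_exponent_le hx1R (by linarith only [hη16, hσ₂])
      linarith only [h1, h2]
    have hd1 : (x : ℝ) ^ σ₁ / 2 ≤ (bP s : ℕ) := by linarith only [hBPge, hPR, hx32, hxσ₁]
    have hd3 : 2 * bP (s + 1) ≤ 3 * bP s := by
      have h1 := hsuccP s
      have h2 : (16 : ℝ) ≤ bP s := hBP16.trans hPR
      have hκP : κ * (bP s : ℕ) ≤ (1 / 4) * (bP s : ℕ) := mul_le_mul_of_nonneg_right hκ4 (by positivity)
      have : (2 : ℝ) * (bP (s + 1) : ℕ) ≤ 3 * (bP s : ℕ) := by linarith only [h1, h2, hκP]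
      exact_mod_cast this
    have hd4 : ((bP (s + 1) : ℕ) : ℝ) ≤ 2 * (x : ℝ) ^ σ₂ := by linarith only [hP'R, Real.rpow_nonneg hx0R.le σ₂]
    have hBD := hdisp x hxx₀ θ η Xb (bP s) (bP (s + 1)) (bM j) (bM (j + 1)) hd1 hP hd3 hd4 hMj hMb'Xb hP'Xb hXbx2
    have hMbR : ((bM j : ℕ) : ℝ) ≤ (bM (j + 1) : ℕ) := by exact_mod_cast hMj.le
    have hlen : ((bM (j + 1) : ℕ) : ℝ) - (bM j : ℕ) + 1 ≤ 4 * κ * (bM (j + 1) : ℕ) := by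
      have h1 := hsuccM j
      have h2 : 3 ≤ κ * bM j := hκM₀.trans (mul_le_mul_of_nonneg_left (hbMge j) hκ0.le)
      have h3 : κ * (bM j : ℕ) ≤ κ * (bM (j + 1) : ℕ) := mul_le_mul_of_nonneg_left hMbR hκ0.le
      have h4 : 0 ≤ κ * (bM (j + 1) : ℕ) := by positivity
      linarith only [h1, h2, h3, h4]
    have hM₀x : (x : ℝ) ^ (σ₁ / 2) ≤ 2 * (M₀ : ℝ) := by linarith only [hM₀ge, hx32]
    have hMb'TMr : ((bM (j + 1) : ℕ) : ℝ) ≤ 2 * q₁ * (x : ℝ) ^ (σ₂ + η) := by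
      have h1 : ((bM (j + 1) : ℕ) : ℝ) ≤ (⌊TMr⌋₊ : ℝ) := by exact_mod_cast hMb'TM.trans (min_le_right _ _)
      exact h1.trans (Nat.floor_le (by positivity))
    have hM₀pos : (0 : ℝ) < M₀ := by exact_mod_cast hM₀1
    have hexp4 : δ + (1 + θ) / 2 + σ₂ ≤ 1 - ν := by
      have hνc₄ : ν ≤ c₄ := hνδ.trans hδc₄
      have hc₄v : c₄ = (1 / 2 - σ₂) / 4 := hc₄
      linarith only [hδc₄, hθc₄, hνc₄, hc₄v, hc₄0]
    exact perbox_bound (σ₁ := σ₁) hq₀ hq₁ hK hL1 hκ0 hκ1 hx1R hq₁R hPpos hP hP'Xb hMj hL₀P hBD hM₀pos (hbMge (j + 1))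
      hlen hM₀x hMb'TMr hP'R hνσ hνδ hδ16 hη16 hσ₂ hexp4 hν0
  have hshellsum := shell_cards_sum_le (q₀ := q₀) (a₀ := a₀) (θ := θ) (η := η) hq₁ bP bM hbPmono hbMmono
    hbP0 hbPS hbM0 hbMS hTPXb hM₀TM hTMXb hBP1 hκ0 hax hratP hratM
  have hxhalf : (x : ℝ) ^ (1 / 2 : ℝ) ≤ (x : ℝ) ^ (1 - η) :=
    Real.rpow_le_rpow_of_exponent_le hx1R (by linarith only [hη16])
  have hx32' : (x : ℝ) ^ (1 - η) ≤ (x : ℝ) ^ (3 / 2 : ℝ) :=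
    Real.rpow_le_rpow_of_exponent_le hx1R (by linarith only [hη0])
  have h2κ0 : 0 < 2 * κ := by linarith only [hκ0]
  have h2κ1 : 2 * κ ≤ 1 := by linarith only [hκ4]
  have hcard₁ := hsh x Xb ((x : ℝ) ^ (1 - η)) (2 * κ) hx3 hxhalf hx32' h2κ0 h2κ1
  have hX₂lo : (x : ℝ) ^ (1 / 2 : ℝ) ≤ (x : ℝ) ^ (1 + θ) / (1 + 2 * κ) := by
    rw [le_div_iff₀ (by linarith only [hκ0])]
    have h1 : (x : ℝ) ^ (1 / 2 : ℝ) * (1 + 2 * κ) ≤ (x : ℝ) ^ (1 / 2 : ℝ) * (3 / 2) :=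
      mul_le_mul_of_nonneg_left (by linarith only [hκ4]) (by positivity)
    have h2 : (x : ℝ) ^ (1 / 2 : ℝ) * (3 / 2) ≤ (x : ℝ) ^ (1 / 2 : ℝ) * (x : ℝ) ^ (1 / 2 : ℝ) := by
      refine mul_le_mul_of_nonneg_left ?_ (by positivity)
      have : (3 : ℝ) ^ (1 / 2 : ℝ) ≤ (x : ℝ) ^ (1 / 2 : ℝ) := Real.rpow_le_rpow (by norm_num) hx3R (by norm_num)
      have h3 : (3 / 2 : ℝ) ≤ (3 : ℝ) ^ (1 / 2 : ℝ) := by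
        rw [show (3 : ℝ) ^ (1 / 2 : ℝ) = Real.sqrt 3 by rw [Real.sqrt_eq_rpow]]
        rw [Real.le_sqrt' (by norm_num)]; norm_num
      linarith only [this, h3]
    have h3 : (x : ℝ) ^ (1 / 2 : ℝ) * (x : ℝ) ^ (1 / 2 : ℝ) = (x : ℝ) ^ (1 : ℝ) := by
      rw [← Real.rpow_add hx0R]; norm_num
    have h4 : (x : ℝ) ^ (1 : ℝ) ≤ (x : ℝ) ^ (1 + θ) := Real.rpow_le_rpow_of_exponent_le hx1R (by linarith only [hθ0])
    linarith only [h1, h2, h3.le, h3.ge, h4]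
  have hX₂hi : (x : ℝ) ^ (1 + θ) / (1 + 2 * κ) ≤ (x : ℝ) ^ (3 / 2 : ℝ) := by
    rw [div_le_iff₀ (by linarith only [hκ0])]
    have h1 : (x : ℝ) ^ (1 + θ) ≤ (x : ℝ) ^ (3 / 2 : ℝ) := Real.rpow_le_rpow_of_exponent_le hx1R (by linarith only [hθ16])
    have h2 : (x : ℝ) ^ (3 / 2 : ℝ) ≤ (x : ℝ) ^ (3 / 2 : ℝ) * (1 + 2 * κ) :=
      le_mul_of_one_le_right (by positivity) (by linarith only [hκ0])
    linarith only [h1, h2]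
  have hcard₂ := hsh x Xb ((x : ℝ) ^ (1 + θ) / (1 + 2 * κ)) (2 * κ) hx3 hX₂lo hX₂hi h2κ0 h2κ1
  set y : ℕ := ⌈2 * κ * ((x : ℝ) + a₁.natAbs)⌉₊ with hy
  have hyle : (y : ℝ) ≤ 4 * κ * x + 1 := by
    have h1 : (y : ℝ) < 2 * κ * ((x : ℝ) + a₁.natAbs) + 1 := Nat.ceil_lt_add_one (by positivity)
    have h2 : 2 * κ * ((x : ℝ) + a₁.natAbs) ≤ 2 * κ * (x + x) :=
      mul_le_mul_of_nonneg_left (by linarith only [haxR]) (by positivity)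
    linarith only [h1, h2]
  have hyx : y ≤ x := by
    have hκx : κ * x ≤ (1 / 8) * x := mul_le_mul_of_nonneg_right hκ8 hx0R.le
    exact_mod_cast (show (y : ℝ) ≤ x by linarith only [hyle, hκx, hx3R])
  have hcard₃ := hτ x y (le_trans (by norm_num) hx3) hyx
  have hκL6 : κ * L ^ 6 * L ^ 3 ≤ 1 := by
    have h1 : L ^ 6 * L ^ 3 = L ^ 9 := by rw [← pow_add]
    have h2 : L ^ 9 ≤ L ^ kκ := pow_le_pow_right₀ hL1 (by omega)
    calc κ * L ^ 6 * L ^ 3 = κ * L ^ 9 := by rw [mul_assoc, h1]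
      _ ≤ κ * L ^ kκ := mul_le_mul_of_nonneg_left h2 hκ0.le
      _ = 1 := hκL
  have hκLc : κ * L ^ c * L ^ 3 ≤ 1 := by
    have hL9 : L ^ 3 ≤ L ^ 9 := pow_le_pow_right₀ hL1 (by norm_num)
    have h1 : L ^ c * L ^ 9 = L ^ kκ := by rw [← pow_add, hkκ]
    calc κ * L ^ c * L ^ 3 ≤ κ * L ^ c * L ^ 9 := mul_le_mul_of_nonneg_left hL9 (by positivity)
      _ = κ * L ^ kκ := by rw [mul_assoc, h1]
      _ = 1 := hκL
  have hlog0 : 0 ≤ Real.log x := by linarith only [hlog1]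
  have hsh1 := sh_term_le hCsh.le hκ0.le hx0R.le hlog1 hlogL hLlog hκL6
  have hτ1 := tau_term_le (c := c) hCτ.le hκ0.le hx0R.le hlog0 hlogL hL0 hyle hκLc
  have hsum_le := hshellsum.trans (add_le_add (add_le_add (hcard₁.trans hsh1) (hcard₂.trans hsh1))
    (hcard₃.trans hτ1))
  have hLXb2 : (1 + Real.log Xb) ^ 2 ≤ 9 * L ^ 2 := by nlinarith only [hLXb, hLXb0]
  have hmul := mul_le_mul hLXb2 hsum_le
    (Finset.sum_nonneg fun _ _ => Finset.sum_nonneg fun _ _ => Nat.cast_nonneg _) (by positivity)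
  have hxν1 : 1 ≤ (x : ℝ) ^ (1 - ν) := Real.one_le_rpow hx1R (by linarith only [hνσ, hσ₁, h12, hσ₂])
  have hx34 : (x : ℝ) ^ (3 / 4 : ℝ) ≤ (x : ℝ) ^ (1 - ν) :=
    Real.rpow_le_rpow_of_exponent_le hx1R (by linarith only [hνδ, hδ16])
  have hshell_total := hmul.trans (shell_total_arith (c := c) (kκ := kκ) hCτ.le hL1 hx0R.le hxν1 hx34 (by omega))
  have hdisp_total := disp_total_arith (SP := (SP : ℝ)) (SM := (SM : ℝ)) (q := (q₁ : ℝ)) (ν := ν) hK.le hL1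
    hκ0.le hκ1 hx0R (Nat.cast_nonneg SM) hSPle hSMle hLAd
  refine ((Finset.abs_sum_le_sum_abs _ _).trans
    (Finset.sum_le_sum fun s _ => Finset.abs_sum_le_sum_abs _ _)).trans ?_
  refine (Finset.sum_le_sum fun s hs => Finset.sum_le_sum fun j hj => hperbox s hs j hj).trans ?_
  rw [Finset.sum_congr rfl fun s _ => Finset.sum_add_distrib, Finset.sum_add_distrib]
  rw [Finset.sum_congr rfl fun s _ => (Finset.mul_sum _ _ _).symm, ← Finset.mul_sum]
  simp only [Finset.sum_const, Finset.card_range, nsmul_eq_mul]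
  have hP0 : 0 ≤ (x : ℝ) / L := by positivity
  have hQ0 : 0 ≤ L ^ (2 * kκ + 6) * (x : ℝ) ^ (1 - ν) := by positivity
  have hs0 : 0 ≤ Real.sqrt (2 * (q₁ : ℝ)) := Real.sqrt_nonneg _
  set P : ℝ := (x : ℝ) / L with hPdef
  set Q : ℝ := L ^ (2 * kκ + 6) * (x : ℝ) ^ (1 - ν) with hQdef
  set sq : ℝ := Real.sqrt (2 * (q₁ : ℝ)) with hsq
  have e1 : 0 ≤ Csh * P := mul_nonneg hCsh.le hP0
  have e2 : 0 ≤ Cτ * P := mul_nonneg hCτ.le hP0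
  have e3 : 0 ≤ K * P := mul_nonneg hK.le hP0
  have e4 : 0 ≤ K * (sq * P) := mul_nonneg hK.le (mul_nonneg hs0 hP0)
  have e5 : 0 ≤ Csh * Q := mul_nonneg hCsh.le hQ0
  have e6 : 0 ≤ Cτ * Q := mul_nonneg hCτ.le hQ0
  have e7 : 0 ≤ K * Q := mul_nonneg hK.le hQ0
  linarith only [hshell_total, hdisp_total, e1, e2, e3, e4, e5, e6, e7]

end MiddleAssembly

/-- **Auxiliary stub `stub_pair_middle_boxes_part`** (head of this helper file; parent stub `stub_pair_middle`):
the boxes part (`m > ⌊x^{σ₁/2}⌋₊`) of the one-sided middle triple sum is `≤ C (x/(1+log x) + (1+log x)^e x^{1−ν})` —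
`MiddleAssembly.boxes_part_le`. -/
theorem stub_pair_middle_boxes_part : ∀ (q₀ a₀ q₁ a₁ : ℤ), 0 < q₀ → 0 < q₁ → IsCoprime q₀ a₀ → IsCoprime q₁ a₁ →
    q₁ * a₀ - q₀ * a₁ ≠ 0 → ∀ (σ₁ σ₂ : ℝ), 0 < σ₁ → σ₁ < σ₂ → σ₂ < 1 / 2 → ∃ C : ℝ, 0 < C ∧ ∃ e : ℕ, ∃ ν : ℝ, 0 < ν ∧ ∃ X₀ : ℕ, ∀ (x : ℕ) (θ η : ℝ), X₀ ≤ x → 0 < θ → θ ≤ min (σ₁ / 4) (min ((1 / 2 - σ₂) / 4) (1 / 16)) → 0 < η → η ≤ min (σ₁ / 4) (min ((1 / 2 - σ₂) / 4) (1 / 16)) → |∑ d₀ ∈ Icc 1 ((q₀.toNat + q₁.toNat) * x + a₀.natAbs + a₁.natAbs), ∑ d₁ ∈ Icc 1 ((q₀.toNat + q₁.toNat) * x + a₀.natAbs + a₁.natAbs), ∑ m ∈ Ioc ⌊(x : ℝ) ^ (σ₁ / 2)⌋₊ ((q₀.toNat + q₁.toNat) * x + a₀.natAbs + a₁.natAbs),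 (if ((d₁ : ℤ) * m - a₁) % q₁ = 0 ∧ (1 ≤ ((d₁ : ℤ) * m - a₁) / q₁ ∧ ((d₁ : ℤ) * m - a₁) / q₁ ≤ x) ∧ (1 ≤ q₀ * (((d₁ : ℤ) * m - a₁) / q₁) + a₀ ∧ (d₀ : ℤ) ∣ q₀ * (((d₁ : ℤ) * m - a₁) / q₁) + a₀) ∧ ((x : ℝ) ^ (1 - η) < (d₀ : ℝ) * d₁ ∧ (d₀ : ℝ) * d₁ ≤ (x : ℝ) ^ (1 + θ) ∧ ((x : ℝ) ^ σ₁ < (d₀ : ℝ) ∧ (d₀ : ℝ) ≤ (x : ℝ) ^ σ₂)) then ((ArithmeticFunction.moebius d₀ : ℝ) * Real.log d₀) * ((ArithmeticFunction.moebius d₁ : ℝ) * Real.log d₁) else 0)| ≤ C * ((x : ℝ) / (1 + Real.log x) + (1 + Real.log x) ^ e * (x : ℝ) ^ (1 - ν)) :=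
  fun _ _ _ _ hq₀ hq₁ hc₀ hc₁ hΔ _ _ hσ₁ h12 hσ₂ => MiddleAssembly.boxes_part_le hq₀ hq₁ hc₀ hc₁ hΔ hσ₁ h12 hσ₂

end Summit.Parity.BatemanHorn.Theorems.PolyMobiusTail.EtaFreeWindow
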